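import Mathlib
import Summits.ValiantsHypothesis.ValiantsHypothesis.Theorems.BarrierLeverPartitionMinorsHitByVPHiddenStatesHubJoinsAxisTable
import Summits.ValiantsHypothesis.ValiantsHypothesis.Theorems.BarrierLeverPartitionMinorsHitByVPHiddenStatesHubJoinsZeta
import Summits.ValiantsHypothesis.ValiantsHypothesis.Theorems.BarrierLeverPartitionMinorsHitByVPHiddenStatesStarJoins

/-!
# Route BarrierLever — item `PartitionMinorsHitByVP` (stmt-ValiantsHypothesis-19717), line `hidden-states`,
# stub `stub_qjoinSharp` (Q_join(h²)): HUB JOINS ARE GOOD FOR ALL ROW FAMILIES up to `r = 2h³ + 4h² + 6h`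

Helper file (`--supports stmt-ValiantsHypothesis-19717`; cell valiant-natproofs, rung V4, 𝒟-side door (c); prover seat
val-np-p8 gen 3, lane `stub_qjoinSharp`). Definition-free; closes NO item. Part 3 of 3 of the axis-table development
(`…HubJoinsAxis`: two-block curve filling + balanced coordinates; `…HubJoinsAxisTable`: the axis table and `core_indep`).

THEOREM (`hubJoin_good_of_balanced`). If a coordinate `y` has at least `m(l+1)` members of the injective row family `u`
avoiding it and at least `m(l+1)` containing it, the hub-join family `HubJoin.hubE` (`m` pieces of `K` states, `l` married
pairs each, `l + 1 ≤ K`, any `r ≤ m(K+1+l)`; a legal strict threshold join family, `HubJoin.hub_threshold`) has a join table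
with nonsingular block-additive matrix for `u`: parameters from `exists_params₂`, structured columns independent by
`core_indep`, free satellites filled by `JoinFilling.exists_table_of_core`.

COROLLARIES (the stub's shape). `qjoinSharp_body_balanced`: `∃` ONE design, `∀ u` with a balanced coordinate, `∃` table.
**`qjoinSharp_of_le_axis`: for `h ≥ 4` and EVERY `r ≤ 2h(h·h+1) + 4h·h + 4h` the body of `Stmt.stub_qjoinSharp` holds FOR
ALL injective `u`** (below the star range by `StarJoin.qjoinSharp_of_le`, p578997; above it `l = (r − 2h(h²+1))/2h + 1` married
pairs per piece, and a balanced coordinate exists by `exists_balanced_coord` because `r > 2h³`). `qjoinSharp_upto_twelve`: the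
body holds for every `r ≤ 2^h` when `1 ≤ h ≤ 12` — the stub's first open window moves from `h = 12, r ∈ (3480, 4096]` to
`h = 13, r ∈ (5148, 8192]`. This is the first statement of the sharp variant beyond the affine room with NO hypothesis on `u`.

WHAT THIS IS NOT: `stub_qjoinSharp` stays open for `h ≥ 13`, `r > 2h³+4h²+6h`; nothing on crux 14610 or VP ≠ VNP.
-/

set_option linter.dupNamespace false

namespace Summit.ValiantsHypothesis.ValiantsHypothesis.Theorems.BarrierLever.HiddenStates

open Finset Matrix

noncomputable section

namespace HubAxis

open TwoLayer (curveVec)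
open JoinFilling (jpt jcol IndepOn det_ne_zero_of_indepOn exists_table_of_core)
open HubJoin (hubStates hubPiece hubE pos_lt hubStates_single hubStates_pair div_mul_add_mod' hubE_injective hub_threshold
  hubW hubWt card_derived_le)

variable {h m K l r : ℕ}

/-! ## 4. Independence of the structured columns -/

/-- The `y`-free part of a row family and the `y`-containing part (with `y` erased): both injective. -/
theorem injective_rows_without {r : ℕ} (u : Fin r → Finset (Fin h)) (hu : Function.Injective u) (y : Fin h) :
    Function.Injective fun i : {i : Fin r // y ∉ u i} => u i.1 :=
  fun _ _ hij => Subtype.ext (hu hij)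

/-- The rows containing `y`, with `y` erased, are still distinct. -/
theorem injective_rows_with {r : ℕ} (u : Fin r → Finset (Fin h)) (hu : Function.Injective u) (y : Fin h) :
    Function.Injective fun i : {i : Fin r // y ∈ u i} => (u i.1).erase y := by
  intro i j hij
  apply Subtype.ext
  apply hu
  have := congrArg (insert y) hij
  simp only at this
  rwa [Finset.insert_erase i.2, Finset.insert_erase j.2] at this

/-- **Core independence.** If the parameters make block 0 independent on the base/low-satellite columns and block 1
independent on the mates of the derived columns, the structured columns of the axis table are independent. -/
theorem core_indep (hl : l + 1 ≤ K) (hr : r ≤ m * (K + 1 + l)) (u : Fin r → Finset (Fin h)) (y : Fin h)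
    (θ : Fin r → ℂ)
    (hθ₀ : IndepOn₂ (fun k : Fin r => curveVec (fun i : {i : Fin r // y ∉ u i} => u i.1) (θ k)) (baseSat K l r))
    (hθ₁ : IndepOn₂ (fun k : Fin r => curveVec (fun i : {i : Fin r // y ∈ u i} => (u i.1).erase y) (θ k))
      ((derived K l r).image (mate hl))) :
    IndepOn (jcol u (hubE hl hr) (axisTab K l y θ)) (coreA K l r) := by
  classical
  intro α hα hsum
  -- split A into base/sat and derived
  have hsplit : ∀ k, k ∈ coreA K l r ↔ (k ∈ baseSat K l r ∨ k ∈ derived K l r) := by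
    intro k; rw [mem_coreA, mem_baseSat, mem_derived]; omega
  have hdisj : ∀ k, ¬ (k ∈ baseSat K l r ∧ k ∈ derived K l r) := by
    intro k; rw [mem_baseSat, mem_derived]; omega
  have hmate_bs : ∀ k ∈ baseSat K l r, mate hl k = k := by
    intro k hk; rw [mem_baseSat] at hk
    have h1 : (k : ℕ) % (K + 1 + l) ≠ 1 := by omega
    have h2 : ¬ K < (k : ℕ) % (K + 1 + l) := by omega
    simp [mate, h1, h2]
  -- entries
  have hentry : ∀ k i, α k * jcol u (hubE hl hr) (axisTab K l y θ) k i =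
      (if k ∈ derived K l r then
        (if y ∈ u i then α k * θ (mate hl k) ^ (∑ a ∈ (u i).erase y, 2 ^ (a : ℕ))
          else α k * θ (mate hl k) ^ (∑ a ∈ u i, 2 ^ (a : ℕ)))
      else (if y ∈ u i then 0 else α k * θ (mate hl k) ^ (∑ a ∈ u i, 2 ^ (a : ℕ)))) := by
    intro k i
    rw [jcol_axisTab hl hr u y θ k i]
    by_cases hd : k ∈ derived K l r
    · have hd' := mem_derived.mp hd
      rw [if_pos hd, if_pos hd']
      split_ifs <;> ring
    · have hd' : ¬ ((k : ℕ) % (K + 1 + l) = 1 ∨ K < (k : ℕ) % (K + 1 + l)) := fun h' => hd (mem_derived.mpr h')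
      rw [if_neg hd, if_neg hd']
      split_ifs <;> ring
  have hrow : ∀ i, ∑ k ∈ coreA K l r, α k * jcol u (hubE hl hr) (axisTab K l y θ) k i = 0 := by
    intro i
    have := congrFun hsum i
    rw [Finset.sum_apply, Pi.zero_apply] at this
    simpa [Pi.smul_apply, smul_eq_mul] using this
  -- step 1: rows containing y kill everything but the derived columns ⇒ α = 0 on derived columns
  set β : Fin r → ℂ := fun t => ∑ k ∈ (derived K l r).filter (fun k => mate hl k = t), α k with hβ
  have hβsum : ∑ t ∈ (derived K l r).image (mate hl),
      β t • curveVec (fun i : {i : Fin r // y ∈ u i} => (u i.1).erase y) (θ t) = 0 := by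
    have hfib := Finset.sum_fiberwise_of_maps_to (s := derived K l r) (t := (derived K l r).image (mate hl))
      (g := mate hl) (f := fun k => α k • curveVec (fun i : {i : Fin r // y ∈ u i} => (u i.1).erase y) (θ (mate hl k)))
      (fun k hk => Finset.mem_image_of_mem _ hk)
    have hinner : ∀ t, ∑ k ∈ (derived K l r).filter (fun k => mate hl k = t),
        α k • curveVec (fun i : {i : Fin r // y ∈ u i} => (u i.1).erase y) (θ (mate hl k)) =
        β t • curveVec (fun i : {i : Fin r // y ∈ u i} => (u i.1).erase y) (θ t) := by
      intro t
      rw [hβ, Finset.sum_smul]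
      refine Finset.sum_congr rfl fun k hk => ?_
      rw [(Finset.mem_filter.mp hk).2]
    rw [← Finset.sum_congr rfl (fun t _ => hinner t), hfib]
    funext i
    rw [Finset.sum_apply, Pi.zero_apply]
    have h1 := hrow i.1
    rw [← Finset.sum_filter_add_sum_filter_not (coreA K l r) (fun k => k ∈ derived K l r)] at h1
    have hz : ∑ k ∈ (coreA K l r).filter (fun k => k ∉ derived K l r),
        α k * jcol u (hubE hl hr) (axisTab K l y θ) k i.1 = 0 := by
      refine Finset.sum_eq_zero fun k hk => ?_
      rw [Finset.mem_filter] at hk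
      rw [hentry, if_neg hk.2, if_pos i.2]
    rw [hz, add_zero] at h1
    have hfil : (coreA K l r).filter (fun k => k ∈ derived K l r) = derived K l r := by
      ext k; rw [Finset.mem_filter, hsplit]; constructor
      · exact fun h' => h'.2
      · exact fun h' => ⟨Or.inr h', h'⟩
    rw [hfil] at h1
    rw [← h1]
    refine Finset.sum_congr rfl fun k hk => ?_
    simp only [Pi.smul_apply, smul_eq_mul, curveVec]
    rw [hentry, if_pos hk, if_pos i.2]
  have hβ0 : ∀ t, t ∉ (derived K l r).image (mate hl) → β t = 0 := by
    intro t ht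
    simp only [hβ]
    refine Finset.sum_eq_zero fun k hk => ?_
    rw [Finset.mem_filter] at hk
    exact absurd (hk.2 ▸ Finset.mem_image_of_mem (mate hl) hk.1) ht
  have hβzero := hθ₁ β hβ0 hβsum
  have hαder : ∀ k ∈ derived K l r, α k = 0 := by
    intro k hk
    have hfib : (derived K l r).filter (fun k' => mate hl k' = mate hl k) = {k} := by
      ext k'
      rw [Finset.mem_filter, Finset.mem_singleton]
      constructor
      · rintro ⟨hk', hmm⟩; exact mate_injOn hl hk' hk hmm
      · rintro rfl; exact ⟨hk, rfl⟩
    have := hβzero (mate hl k)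
    simp only [hβ, hfib, Finset.sum_singleton] at this
    exact this
  -- step 2: rows avoiding y now see only the base/satellite columns ⇒ α = 0 there
  set α' : Fin r → ℂ := fun k => if k ∈ baseSat K l r then α k else 0 with hα'
  have hα'sum : ∑ k ∈ baseSat K l r, α' k • curveVec (fun i : {i : Fin r // y ∉ u i} => u i.1) (θ k) = 0 := by
    funext i
    rw [Finset.sum_apply, Pi.zero_apply]
    have h1 := hrow i.1
    rw [← Finset.sum_filter_add_sum_filter_not (coreA K l r) (fun k => k ∈ derived K l r)] at h1
    have hz : ∑ k ∈ (coreA K l r).filter (fun k => k ∈ derived K l r),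
        α k * jcol u (hubE hl hr) (axisTab K l y θ) k i.1 = 0 := by
      refine Finset.sum_eq_zero fun k hk => ?_
      rw [Finset.mem_filter] at hk
      rw [hαder k hk.2, zero_mul]
    rw [hz, zero_add] at h1
    have hfil : (coreA K l r).filter (fun k => k ∉ derived K l r) = baseSat K l r := by
      ext k; rw [Finset.mem_filter, hsplit]
      constructor
      · rintro ⟨h' | h', hnd⟩; exact h'; exact absurd h' hnd
      · intro h'; exact ⟨Or.inl h', fun hd => hdisj k ⟨h', hd⟩⟩
    rw [hfil] at h1
    rw [← h1]
    refine Finset.sum_congr rfl fun k hk => ?_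
    have hkd : k ∉ derived K l r := fun hd => hdisj k ⟨hk, hd⟩
    simp only [Pi.smul_apply, smul_eq_mul, curveVec, hα', if_pos hk]
    rw [hentry, if_neg hkd, if_neg i.2, hmate_bs k hk]
  have hα'zero := hθ₀ α' (fun k hk => by simp only [hα', if_neg hk]) hα'sum
  -- conclusion
  intro k
  by_cases hkA : k ∈ coreA K l r
  · rcases (hsplit k).mp hkA with hb | hd
    · have := hα'zero k; simp only [hα', if_pos hb] at this; exact this
    · exact hαder k hd
  · exact hα k hkA


/-! ## 5. Assembly: hub joins are good for row families with a balanced coordinate -/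

/-- The base/low-satellite columns number at most `m(l+1)`. -/
theorem card_baseSat_le (hr : r ≤ m * (K + 1 + l)) : (baseSat K l r).card ≤ m * (l + 1) := by
  classical
  let ι : Fin r → Fin m × Fin (l + 1) := fun k =>
    (hubPiece hr k, if hk : (k : ℕ) % (K + 1 + l) = 0 then ⟨0, by omega⟩
      else ⟨min ((k : ℕ) % (K + 1 + l) - 1) l, by omega⟩)
  have hinj : Set.InjOn ι (baseSat K l r) := by
    intro k hk k' hk' hkk
    rw [Finset.mem_coe, mem_baseSat] at hk hk'
    simp only [ι, Prod.mk.injEq, hubPiece, Fin.mk.injEq] at hkk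
    obtain ⟨hp, hq⟩ := hkk
    have hj : (k : ℕ) % (K + 1 + l) = (k' : ℕ) % (K + 1 + l) := by
      rcases hk with h0 | ⟨h2, h2'⟩ <;> rcases hk' with h0' | ⟨h3, h3'⟩
      · omega
      · rw [dif_pos h0, dif_neg (by omega)] at hq; have := congrArg Fin.val hq; simp at this; omega
      · rw [dif_neg (by omega), dif_pos h0'] at hq; have := congrArg Fin.val hq; simp at this; omega
      · rw [dif_neg (by omega), dif_neg (by omega)] at hq; have := congrArg Fin.val hq; simp at this; omega
    apply Fin.ext
    rw [← div_mul_add_mod' (k : ℕ) (K + 1 + l), ← div_mul_add_mod' (k' : ℕ) (K + 1 + l), hp, hj]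
  have := Finset.card_le_card_of_injOn ι (fun k _ => Finset.mem_univ (ι k)) hinj
  simpa [Finset.card_univ, Fintype.card_prod, Fintype.card_fin] using this

/-- **Hub joins are good for every row family with a balanced coordinate.** If some coordinate `y` has at least `m(l+1)`
members of the injective row family `u` avoiding it and at least `m(l+1)` containing it, the hub-join family (`m` pieces of `K`
states, `l` married pairs each, `l + 1 ≤ K`, any `r ≤ m(K+1+l)`) has a join table with nonsingular block-additive matrix. -/
theorem hubJoin_good_of_balanced (hl : l + 1 ≤ K) (hr : r ≤ m * (K + 1 + l)) (u : Fin r → Finset (Fin h))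
    (hu : Function.Injective u) (y : Fin h)
    (hy₀ : m * (l + 1) ≤ (Finset.univ.filter fun i : Fin r => y ∉ u i).card)
    (hy₁ : m * (l + 1) ≤ (Finset.univ.filter fun i : Fin r => y ∈ u i).card) :
    ∃ tx : Fin m → Option (Fin K) → Fin h → ℂ,
      (Matrix.of fun i k : Fin r =>
        ∏ a ∈ u i, (tx (hubE hl hr k).1 none a + ∑ q ∈ (hubE hl hr k).2, tx (hubE hl hr k).1 (some q) a)).det ≠ 0 := by
  classical
  have hT : (derived K l r).image (mate hl) ⊆ baseSat K l r :=
    Finset.image_subset_iff.mpr fun k hk => mate_mem_baseSat hl k hk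
  have h₀ : (baseSat K l r).card ≤ Fintype.card {i : Fin r // y ∉ u i} := by
    rw [Fintype.card_subtype]; exact (card_baseSat_le hr).trans hy₀
  have h₁ : ((derived K l r).image (mate hl)).card ≤ Fintype.card {i : Fin r // y ∈ u i} := by
    rw [Fintype.card_subtype]
    exact Finset.card_image_le.trans ((card_derived_le hl hr).trans hy₁)
  obtain ⟨θ, hθ₀, hθ₁⟩ := exists_params₂ (fun i : {i : Fin r // y ∉ u i} => u i.1) (injective_rows_without u hu y)
    (fun i : {i : Fin r // y ∈ u i} => (u i.1).erase y) (injective_rows_with u hu y)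
    (baseSat K l r) ((derived K l r).image (mate hl)) hT h₀ h₁
  exact exists_table_of_core hu (hubE_free hl hr) (fun k hk k' hp hmem => hubE_priv hl hr k hk k' hp hmem)
    (core_indep hl hr u y θ hθ₀ hθ₁)

/-! ## 6. The stub's body: with a balanced coordinate, and for ALL row families up to `2h³ + 4h² + 6h` -/

/-- **Q_join(h²) with a balanced coordinate** (the stub's shape, `u` restricted): for `l + 1 ≤ h·h` and
`r ≤ 2h(h·h+1+l)` ONE join threshold family (`hubE`, `2h` pieces of `h·h` states) is good for every injective
`u : Fin r → Finset (Fin h)` having a coordinate with at least `2h(l+1)` members on each side. -/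
theorem qjoinSharp_body_balanced (h l r : ℕ) (hl : l + 1 ≤ h * h) (hr : r ≤ (h + h) * (h * h + 1 + l)) :
    ∃ (m : ℕ) (W : Fin m → ℕ) (wt : Fin m → Fin (h * h) → ℕ) (e : Fin r → Fin m × Finset (Fin (h * h))),
      m ≤ h + h ∧ Function.Injective e ∧
      (∀ x : Fin m × Finset (Fin (h * h)), x ∉ Set.range e →
        ∀ i, W (e i).1 + ∑ k ∈ (e i).2, wt (e i).1 k < W x.1 + ∑ k ∈ x.2, wt x.1 k) ∧
      ∀ u : Fin r → Finset (Fin h), Function.Injective u →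
        (∃ y : Fin h, (h + h) * (l + 1) ≤ (Finset.univ.filter fun i : Fin r => y ∉ u i).card ∧
          (h + h) * (l + 1) ≤ (Finset.univ.filter fun i : Fin r => y ∈ u i).card) →
        ∃ tx : Fin m → Option (Fin (h * h)) → Fin h → ℂ,
          (Matrix.of fun i k : Fin r =>
            ∏ a ∈ u i, (tx (e k).1 none a + ∑ q ∈ (e k).2, tx (e k).1 (some q) a)).det ≠ 0 := by
  refine ⟨h + h, hubW (h * h) l r, hubWt (h * h) l r, hubE hl hr, le_rfl, hubE_injective hl hr, hub_threshold hl hr, ?_⟩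
  rintro u hu ⟨y, hy₀, hy₁⟩
  exact hubJoin_good_of_balanced hl hr u hu y hy₀ hy₁

/-- **Q_join(h²) FOR ALL ROW FAMILIES up to `2h³ + 4h² + 6h`.** For `h ≥ 4` and every `r ≤ 2h(h·h+1) + 4h·h + 4h` the body
of `Stmt.stub_qjoinSharp` holds at `(h, r)`: ONE join threshold family with `≤ 2h` pieces of `h·h` states is good for EVERY
injective `u : Fin r → Finset (Fin h)` (below the star range by `StarJoin.qjoinSharp_of_le`; above it the hub-join family with
`l = (r − 2h(h²+1))/2h + 1` married pairs per piece and a balanced coordinate, which exists since `r > 2h³`). -/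
theorem qjoinSharp_of_le_axis (h r : ℕ) (hh : 4 ≤ h) (hr : r ≤ (h + h) * (h * h + 1) + 4 * (h * h) + 4 * h) :
    ∃ (m : ℕ) (W : Fin m → ℕ) (wt : Fin m → Fin (h * h) → ℕ) (e : Fin r → Fin m × Finset (Fin (h * h))),
      m ≤ h + h ∧ Function.Injective e ∧
      (∀ x : Fin m × Finset (Fin (h * h)), x ∉ Set.range e →
        ∀ i, W (e i).1 + ∑ k ∈ (e i).2, wt (e i).1 k < W x.1 + ∑ k ∈ x.2, wt x.1 k) ∧
      ∀ u : Fin r → Finset (Fin h), Function.Injective u →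
        ∃ tx : Fin m → Option (Fin (h * h)) → Fin h → ℂ,
          (Matrix.of fun i k : Fin r =>
            ∏ a ∈ u i, (tx (e k).1 none a + ∑ q ∈ (e k).2, tx (e k).1 (some q) a)).det ≠ 0 := by
  by_cases hsmall : r ≤ (h + h) * (h * h + 1)
  · exact StarJoin.qjoinSharp_of_le h r hsmall
  push Not at hsmall
  -- the excess over the star range and the number of married pairs per piece
  set L := r - (h + h) * (h * h + 1) with hL
  have hLr : r = (h + h) * (h * h + 1) + L := by omega
  have hLle : L ≤ 4 * (h * h) + 4 * h := by omega
  have hh0 : 0 < h + h := by omega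
  set l := L / (h + h) + 1 with hl'
  have hdiv : L / (h + h) ≤ 2 * h + 2 := by
    apply Nat.div_le_of_le_mul
    nlinarith
  have hl : l + 1 ≤ h * h := by nlinarith
  have hLl : L ≤ (h + h) * l := by
    have := Nat.div_add_mod L (h + h)
    have hmod := Nat.mod_lt L hh0
    nlinarith
  have hr' : r ≤ (h + h) * (h * h + 1 + l) := by nlinarith
  obtain ⟨m, W, wt, e, hm, he, hthr, hgood⟩ := qjoinSharp_body_balanced h l r hl hr'
  refine ⟨m, W, wt, e, hm, he, hthr, fun u hu => hgood u hu ?_⟩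
  -- a balanced coordinate with 2h(l+1) members on each side
  have hcount : h * ((h + h) * (l + 1)) + h + 2 < 2 * r := by
    have hml : (h + h) * (L / (h + h)) ≤ L := Nat.mul_div_le L (h + h)
    obtain ⟨h', rfl⟩ : ∃ h', h = h' + 4 := ⟨h - 4, by omega⟩
    nlinarith
  exact exists_balanced_coord u hu _ hcount

/-- `2^h ≤ 2h(h²+1) + 4h² + 4h` for `4 ≤ h ≤ 12` (at `h = 12`: `4096 ≤ 4104`). -/
theorem two_pow_le_axis_range (h : ℕ) (h4 : 4 ≤ h) (h12 : h ≤ 12) :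
    2 ^ h ≤ (h + h) * (h * h + 1) + 4 * (h * h) + 4 * h := by
  interval_cases h <;> norm_num

/-- **Q_join(h²) for `h ≤ 12`**: for `1 ≤ h ≤ 12` the body of `Stmt.stub_qjoinSharp` holds for EVERY `r ≤ 2^h` (h ≤ 11 is
the star range, `StarJoin.qjoinSharp_upto_eleven`; h = 12 — the stub's first open window `(3480, 4096]` — is closed by the
axis table). The first open window is now `h = 13`, `r ∈ (5148, 8192]`. -/
theorem qjoinSharp_upto_twelve (h : ℕ) (h1 : 1 ≤ h) (h12 : h ≤ 12) (r : ℕ) (hr : r ≤ 2 ^ h) :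
    ∃ (m : ℕ) (W : Fin m → ℕ) (wt : Fin m → Fin (h * h) → ℕ) (e : Fin r → Fin m × Finset (Fin (h * h))),
      m ≤ h + h ∧ Function.Injective e ∧
      (∀ x : Fin m × Finset (Fin (h * h)), x ∉ Set.range e →
        ∀ i, W (e i).1 + ∑ k ∈ (e i).2, wt (e i).1 k < W x.1 + ∑ k ∈ x.2, wt x.1 k) ∧
      ∀ u : Fin r → Finset (Fin h), Function.Injective u →
        ∃ tx : Fin m → Option (Fin (h * h)) → Fin h → ℂ,
          (Matrix.of fun i k : Fin r =>
            ∏ a ∈ u i, (tx (e k).1 none a + ∑ q ∈ (e k).2, tx (e k).1 (some q) a)).det ≠ 0 := by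
  by_cases h11 : h ≤ 11
  · exact StarJoin.qjoinSharp_upto_eleven h h1 h11 r hr
  · have h4 : 4 ≤ h := by omega
    exact qjoinSharp_of_le_axis h r h4 (hr.trans (two_pow_le_axis_range h h4 h12))

end HubAxis

end

end Summit.ValiantsHypothesis.ValiantsHypothesis.Theorems.BarrierLever.HiddenStates
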